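import Summits.BirchSwinnertonDyer.Rank1Residual.Additive.RationalClassesToLayerZero
import Summits.BirchSwinnertonDyer.Rank1Residual.Additive.GoodModelKummerOfCoatesGreenberg
import Summits.BirchSwinnertonDyer.Rank1Residual.X2.GreenbergVatsalReductionDatum
import HarnessLib

/-!
# The `ℚ_∞`-local condition at `p` for mod-`p` classes (hypothesis `hloc` of
# `X1/GeneratorCountAnomalous.lean`) REDUCED TO STRICTNESS by Greenberg's Prop. 2.4 taken by name
# (cell `b2b-bsdres`, unit `b2b-bsdres-eisenstein-p1`, gen 15; V79 socket)

HONEST FRAMING (run/shared/lean/b2b/bsd-rank1-residual/, verbatim in every file): the goal of the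
cell is to DELETE the COMBINATION-SHAPED residual classes of the Birch–Swinnerton-Dyer formula for
ALL analytic-rank `≤ 1` elliptic curves over `ℚ` — "full BSD formula for every rank `≤ 1` curve in
class `C`" assembled STRICTLY from published theorems — so that the rank-`≤ 1` remainder becomes
exactly the CONSTRUCTION-SHAPED classes, which are TYPED (missing-input `Prop`s), NOT attempted.
This is not "finishing BSD". Sub-cell `b2b-bsdres-eisenstein-p1`: research route; NO CLAIM BEYOND
STATED CLASSES; nothing here changes a label; nothing is booked. THEOREMS ONLY; the named fact is
PUBLISHED (Greenberg 1999 Prop. 2.4 `Greenberg1999.imKummer_ge_strictCondition_goodOrdinary`, resp.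
Coates–Greenberg 1996 Cor. 3.2 `CoatesGreenberg1996.H1_goodModelKernel_trivial` from which the tree
derives it).

What. The count files `X1/GeneratorCountAnomalous(Two)` carry ONE local hypothesis `hloc`: every
class of `H¹(ℚ, E[p])`, restricted to `Gal(ℚ̄/ℚ_∞)`, satisfies the Kummer condition over `ℚ_∞` at
the place above `p` (`localKerOver`). Greenberg's Prop. 2.4 (`Im λ ⊆ Im κ` over `ℚ_{∞,𝔭}`) reduces
this to the STRICT condition for the reduction datum `C_v = ker red_v`
(`X2.GreenbergVatsalReductionDatum.reductionDatum`): `mem_localKerOver_of_mem_strictKer` (the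
fact applied with `specVal`, `localRed`, `mem_reductionDatum_plus_iff`, `H = ker κ`), and
`hloc_of_forall_mem_strictKer(_of_coatesGreenberg)`. What remains (X1R0-GAPMAP §24.5, V79) is the
strictness at an ANOMALOUS prime: `Ẽ[p]` is `Gal(ℚ̄_p/ℚ_p)`-trivial, `H¹(ℚ_p, 𝔽_p) = H¹_ur ⊕ 𝔽_p κ̄`
(`p²` classes, a tree theorem), `κ̄` dies on `Gal(ℚ̄_p/ℚ_{p,∞})` and unramified classes are
coboundaries in `Ẽ[p^∞]`.

References: [GreenbergLNM1716] §2 Prop. 2.4 (pp. 74–75), §3 Lemma 3.4 (p. 89); [CoatesGreenberg1996]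
Cor. 3.2; X1R0-GAPMAP §24.2, §24.5.
-/

noncomputable section

open scoped Classical

open Function Field NumberField IsDedekindDomain WeierstrassCurve
  Literature.NumberTheory.EllipticCurves Literature.NumberTheory.GaloisRepresentations
  Literature.NumberTheory.EllipticCurves.Greenberg1999 Literature.NumberTheory.EllipticCurves.GreenbergSelmer
  Summit.BirchSwinnertonDyer.Rank1Residual.X2.GreenbergVatsalReductionDatum

set_option autoImplicit false

namespace Summit.BirchSwinnertonDyer.Rank1Residual.X1.AnomalousTowerLocalCondition

variable (W : WeierstrassCurve ℚ) [W.IsElliptic] [W.IsGloballyMinimal] (p : ℕ) [hp : Fact p.Prime]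

/-- **`hloc` from STRICTNESS, one class** (Greenberg Prop. 2.4 BY NAME): if the restriction to `Gal(ℚ̄/ℚ_∞)`
of `(E[p] ↪ E[p^∞])_* y` is STRICT at `v ∋ p` for the reduction datum `C_v = ker red_v`, then it
satisfies the Kummer condition over `ℚ_∞` there. [cite: GreenbergLNM1716, §2 Prop. 2.4 (pp. 74–75)] -/
theorem mem_localKerOver_of_mem_strictKer (hGrK : imKummer_ge_strictCondition_goodOrdinary)
    (hΔ : ¬ (p : ℤ) ∣ minimalDiscriminantInt W) (hord : ¬ (p : ℤ) ∣ W.frobeniusTrace p)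
    (κ : ZpExtension ℚ p) (hκ : κ.IsCyclotomic) (v : HeightOneSpectrum (𝓞 ℚ))
    (hpv : ((p : ℕ) : 𝓞 ℚ) ∈ v.asIdeal) (c : W.subgroupH1 p κ.kerSubgroup)
    (hc : c ∈ (reductionDatum W p hpv hΔ).strictKer κ.kerSubgroup) :
    c ∈ W.localKerOver p κ.kerSubgroup (v.adicCompletion ℚ) := by
  haveI : (κ.kerSubgroup.subgroupOf κ.kerSubgroup).FiniteIndex := by
    rw [Subgroup.subgroupOf_self]; infer_instance
  exact hGrK W p hΔ hord κ hκ v hpv (specVal v) (specVal_spec v) (localRed W p hpv hΔ)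
    (localRed_apply W p hpv hΔ) (reductionDatum W p hpv hΔ) (mem_reductionDatum_plus_iff W p hpv hΔ)
    κ.kerSubgroup (ZpExtension.isClosed_kerSubgroup κ) le_rfl inferInstance hc

/-- §B′. **`hloc` FROM STRICTNESS, packaged in the shape of `X1/GeneratorCountAnomalous` §1**: if at
the place above `p` every class `h_0(Ψ y)`, `y ∈ H¹(ℚ, E[p])`, is STRICT for the reduction datum
(the successor's target V79, true at an anomalous good ordinary prime — X1R0-GAPMAP §24.5), then
the local hypothesis `hloc` of the count files holds, Greenberg's Prop. 2.4 taken BY NAME (`hGrK`,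
derivable from the Coates–Greenberg record `CoatesGreenberg1996.H1_goodModelKernel_trivial` by
`Additive.GoodModelLine.imKummer_ge_strictCondition_goodOrdinary_of_coatesGreenberg`).
[cite: GreenbergLNM1716, §2 Prop. 2.4 (pp. 74–75) and §3 Lemma 3.4 (p. 89)] -/
theorem hloc_of_forall_mem_strictKer (hGrK : imKummer_ge_strictCondition_goodOrdinary)
    (hΔ : ¬ (p : ℤ) ∣ minimalDiscriminantInt W) (hord : ¬ (p : ℤ) ∣ W.frobeniusTrace p)
    (hstrict : ∀ (κ : ZpExtension ℚ p), κ.IsCyclotomic → ∀ (v : HeightOneSpectrum (𝓞 ℚ))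
      (hpv : ((p : ℕ) : 𝓞 ℚ) ∈ v.asIdeal), ∀ y : galH1Torsion W (p : ℤ),
      W.layerToInfty κ 0 (resH1Hom (Literature.NumberTheory.EllipticCurves.subgroupIncl (κ.layerSubgroup 0))
          (AddMonoidHom.id (geomPrimaryTorsion W p)) (fun _ _ ↦ rfl) (torsionToPrimaryH1 W p y)) ∈
        (reductionDatum W p hpv hΔ).strictKer κ.kerSubgroup) :
    ∀ (κ : ZpExtension ℚ p), κ.IsCyclotomic → ∀ (v : HeightOneSpectrum (𝓞 ℚ)),
      ((p : ℕ) : 𝓞 ℚ) ∈ v.asIdeal → ∀ y : galH1Torsion W (p : ℤ),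
      W.layerToInfty κ 0 (resH1Hom (Literature.NumberTheory.EllipticCurves.subgroupIncl (κ.layerSubgroup 0))
          (AddMonoidHom.id (geomPrimaryTorsion W p)) (fun _ _ ↦ rfl) (torsionToPrimaryH1 W p y)) ∈
        W.localKerOver p κ.kerSubgroup (v.adicCompletion ℚ) :=
  fun κ hκ v hpv y ↦ mem_localKerOver_of_mem_strictKer W p hGrK hΔ hord κ hκ v hpv _
    (hstrict κ hκ v hpv y)

/-- The same with the Coates–Greenberg record as the named fact (`hCG`, Cor. 3.2 through LNM 1716),
Prop. 2.4 being DERIVED from it in the tree (`Additive.GoodModelLine.imKummer_ge_strictCondition_goodOrdinary_of_coatesGreenberg`).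
[cite: CoatesGreenberg1996, Cor. 3.2 (through GreenbergLNM1716, Coates p. 37 (74))] [cite: GreenbergLNM1716, §2 Prop. 2.4 (pp. 74–75)] -/
theorem hloc_of_forall_mem_strictKer_of_coatesGreenberg
    (hCG : CoatesGreenberg1996.H1_goodModelKernel_trivial.{0})
    (hΔ : ¬ (p : ℤ) ∣ minimalDiscriminantInt W) (hord : ¬ (p : ℤ) ∣ W.frobeniusTrace p)
    (hstrict : ∀ (κ : ZpExtension ℚ p), κ.IsCyclotomic → ∀ (v : HeightOneSpectrum (𝓞 ℚ))
      (hpv : ((p : ℕ) : 𝓞 ℚ) ∈ v.asIdeal), ∀ y : galH1Torsion W (p : ℤ),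
      W.layerToInfty κ 0 (resH1Hom (Literature.NumberTheory.EllipticCurves.subgroupIncl (κ.layerSubgroup 0))
          (AddMonoidHom.id (geomPrimaryTorsion W p)) (fun _ _ ↦ rfl) (torsionToPrimaryH1 W p y)) ∈
        (reductionDatum W p hpv hΔ).strictKer κ.kerSubgroup) :
    ∀ (κ : ZpExtension ℚ p), κ.IsCyclotomic → ∀ (v : HeightOneSpectrum (𝓞 ℚ)),
      ((p : ℕ) : 𝓞 ℚ) ∈ v.asIdeal → ∀ y : galH1Torsion W (p : ℤ),
      W.layerToInfty κ 0 (resH1Hom (Literature.NumberTheory.EllipticCurves.subgroupIncl (κ.layerSubgroup 0))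
          (AddMonoidHom.id (geomPrimaryTorsion W p)) (fun _ _ ↦ rfl) (torsionToPrimaryH1 W p y)) ∈
        W.localKerOver p κ.kerSubgroup (v.adicCompletion ℚ) :=
  hloc_of_forall_mem_strictKer W p
    (Additive.GoodModelLine.imKummer_ge_strictCondition_goodOrdinary_of_coatesGreenberg hCG) hΔ hord hstrict

end Summit.BirchSwinnertonDyer.Rank1Residual.X1.AnomalousTowerLocalCondition

end
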